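import Summits.SmoothPoincare4.SmoothPoincare4.Theorems.ConvexBisectionAcyclicBisectionExistsCrossingNumberGenerators
import Summits.SmoothPoincare4.SmoothPoincare4.Theorems.ConvexBisectionAcyclicBisectionExistsBeltFramingFamilies
import HarnessLib

/-!
# Seam transport, ST3a: the shadow of a seam-pushed page loop is a LINEAR function of its shadow
(wave 4, brick ST3a of sub-node ST3 `node_ST3_shadowTransport` of node T3c-2 `node_seam_transport`
of stub `stub_steinRealisation` = NF6, line `modp-braid-orbits` r11, crux
`ConvexBisection.AcyclicBisectionExists`, item stmt-SmoothPoincare4-10508; registered sub-goal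
`helper_seam_shadowLinear`)

Data: `X = Base g ∪_{h̄} (handles)` (data `D`), a boundary datum `bX` of `X` and a seam
`Ψ : bX.carrier ≅ ∂ Base g`; a unit direction `c` whose page `page g c` misses the cores (a
NON-CRITICAL direction).  Every point `a` of the page is a boundary point of `Base g`
(`page_subset_boundary`), so `D.jA a` is a boundary point of `X` (`isBoundaryPoint_jA_iff`) and
LIFTS through `bX.incl` (`exists_pageLift`); any such lift `λ : page g c → bX.carrier` is continuous
(`bX.incl` is an embedding), and the page is pushed into `Base g` by the continuous
`F_c := (bBase g).incl ∘ Ψ ∘ λ`.  The homology shadow of a page loop `K` factors through its class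
in `H₁(page g c; ℤ) ≅ H₁(Base g; ℤ) ≅ ℤ^{2g}` (Z6-2: `bijective_shadowMap_map_pageIncl`,
`shadow_eq_shadowMap_map_pageIncl`), so BY NATURALITY OF THE HUREWICZ CLASS (`map_loopClass`) the
shadow of the pushed loop `F_c ∘ K` is `A_c (shadow K)` for the `ℤ`-LINEAR map
`A_c := shadowMap ∘ (F_c)_* ∘ (shadowMap ∘ incl_*)⁻¹ : ℤ^{2g} → ℤ^{2g}` (`exists_shadowLinear`); the
lifts `z` of the node (`bX.incl (z θ) = D.jA (K θ)`) are forced to be `λ ∘ K` (`bX.incl` is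
injective), which gives the registered form `helper_seam_shadowLinear`.  (That `A_c` is an
AUTOMORPHISM — brick ST3b — needs the page clause, the inverse seam map and the straightening
isotopy; the critical directions — brick ST3c — reduce to this one by a small page rotation.)

Everything is proved; no named facts, no `sorry`, no new definitions.  References: J. Milnor,
*Singular points of complex hypersurfaces* (1968), Thm. 9.1 [Milnor1968]; A. Hatcher, *Algebraic
Topology* (2002), Thm. 2A.1 [HatcherAT2002].
-/

noncomputable section

set_option linter.dupNamespace false

open scoped Manifold ContDiff Topology

namespace Summit.SmoothPoincare4.SmoothPoincare4.Theorems.AcyclicBisectionExists.ModpBraidOrbits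

open Set Function Filter Metric Topology
open Literature.Topology.FourManifolds Literature.Topology.FourManifolds.HandleAttachingMap
  Literature.Topology.FourManifolds.LefschetzBase Literature.AlgebraicTopology.SingularHomology

section ShadowLinear

variable {g : ℕ} {ι : Type} [Finite ι] {h : ι → HandleAttachingMap 3 2 (Base g)}
  {X : Type} [TopologicalSpace X] [ChartedSpace (EuclideanHalfSpace 4) X]
  (D : MultiAttachmentData h (𝓡∂ 4) X) (bX : BoundaryData (𝓡∂ 4) X (𝓡 3))
  (Ψ : bX.carrier ≃ₘ⟮𝓡 3, 𝓡 3⟯ (bBase g).carrier) {c : ℂ}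

/-- **Points of a page off the cores lift through `bX.incl`**: a page point is a boundary point of
the base, so its image under `jA` is a boundary point of `X`. [cite: Kosinski1993, VI §6] -/
theorem exists_pageLift [IsManifold (𝓡∂ 4) ∞ X] (hc : ‖c‖ = 1) (hfree : ∀ a ∈ page g c, a ∈ coresComplement h) :
    ∃ lam : ↥(page g c) → bX.carrier, ∀ a, bX.incl (lam a) = D.jA ⟨a.1, hfree a.1 a.2⟩ := by
  have hmem : ∀ a : ↥(page g c), D.jA ⟨a.1, hfree a.1 a.2⟩ ∈ range bX.incl := fun a => by
    rw [bX.range_incl]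
    exact (isBoundaryPoint_jA_iff D ⟨a.1, hfree a.1 a.2⟩).2 (page_subset_boundary g hc a.2)
  choose lam hlam using hmem
  exact ⟨lam, hlam⟩

/-- **Any lift of the page through `bX.incl` is continuous** (`bX.incl` is a topological embedding
and `bX.incl ∘ λ = jA ∘ incl` is continuous). [folklore] -/
theorem continuous_pageLift (hfree : ∀ a ∈ page g c, a ∈ coresComplement h)
    {lam : ↥(page g c) → bX.carrier} (hlam : ∀ a, bX.incl (lam a) = D.jA ⟨a.1, hfree a.1 a.2⟩) :
    Continuous lam := by
  rw [bX.isSmoothEmbedding.isEmbedding.continuous_iff]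
  have e : bX.incl ∘ lam = fun a : ↥(page g c) => D.jA ⟨a.1, hfree a.1 a.2⟩ := funext hlam
  rw [e]
  exact D.hjA.isEmbedding.continuous.comp (continuous_subtype_val.subtype_mk _)

/-- The seam push of the page, `F_c := (bBase g).incl ∘ Ψ ∘ λ`, is continuous. [folklore] -/
theorem continuous_pagePush (hfree : ∀ a ∈ page g c, a ∈ coresComplement h)
    {lam : ↥(page g c) → bX.carrier} (hlam : ∀ a, bX.incl (lam a) = D.jA ⟨a.1, hfree a.1 a.2⟩) :
    Continuous fun a : ↥(page g c) => ((bBase g).incl (Ψ (lam a)) : Base g) :=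
  (bBase g).continuous_incl.comp (Ψ.continuous.comp (continuous_pageLift D bX hfree hlam))

/-- **The shadow of the pushed page loops is linear in the shadow**: there is a `ℤ`-linear
`A : ℤ^{2g} → ℤ^{2g}` with `shadow (F_c ∘ K) = A (shadow K)` for every loop `K` of the page
(`A := shadowMap ∘ (F_c)_* ∘ (shadowMap ∘ incl_*)⁻¹`, naturality of the Hurewicz class).
[cite: HatcherAT2002, Thm. 2A.1] -/
theorem exists_shadowLinear (hc : ‖c‖ = 1) (hfree : ∀ a ∈ page g c, a ∈ coresComplement h)
    {lam : ↥(page g c) → bX.carrier} (hlam : ∀ a, bX.incl (lam a) = D.jA ⟨a.1, hfree a.1 a.2⟩) :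
    ∃ A : (Fin g ⊕ Fin g → ℤ) →ₗ[ℤ] (Fin g ⊕ Fin g → ℤ),
      ∀ (K : sphere (0 : EuclideanSpace ℝ (Fin 2)) 1 → Base g) (hK : Continuous K)
        (hKp : ∀ θ, K θ ∈ page g c),
        shadow g (fun θ => ((bBase g).incl (Ψ (lam ⟨K θ, hKp θ⟩)) : Base g))
            ((continuous_pagePush D bX Ψ hfree hlam).comp (hK.subtype_mk hKp)) =
          A (shadow g K hK) := by
  -- the three maps: page inclusion `i`, page push `F`, and the chain coordinates `e` of `H₁(page)`
  set i : C(↥(page g c), Base g) := ⟨Subtype.val, continuous_subtype_val⟩ with hi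
  set F : C(↥(page g c), Base g) := ⟨fun a => ((bBase g).incl (Ψ (lam a)) : Base g),
    continuous_pagePush D bX Ψ hfree hlam⟩ with hF
  have hbij : Function.Bijective ((shadowMap g).comp (singularHomology.map ℤ ℤ i 1).hom) :=
    bijective_shadowMap_map_pageIncl g hc
  set e : singularHomology ℤ ℤ ↥(page g c) 1 ≃ₗ[ℤ] (Fin g ⊕ Fin g → ℤ) :=
    LinearEquiv.ofBijective ((shadowMap g).comp (singularHomology.map ℤ ℤ i 1).hom) hbij with he
  refine ⟨(shadowMap g).comp ((singularHomology.map ℤ ℤ F 1).hom.comp e.symm.toLinearMap),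
    fun K hK hKp => ?_⟩
  -- the class of `K` in the page and its chain coordinates
  have hx : e (loopClass ℤ ℤ (1 : ℤ) (loopPath (fun θ => (⟨K θ, hKp θ⟩ : ↥(page g c)))
      (hK.subtype_mk hKp))) = shadow g K hK := by
    rw [shadow_eq_shadowMap_map_pageIncl hK hKp]
    rfl
  have hx' : e.symm (shadow g K hK) = loopClass ℤ ℤ (1 : ℤ)
      (loopPath (fun θ => (⟨K θ, hKp θ⟩ : ↥(page g c))) (hK.subtype_mk hKp)) := by
    rw [← hx, LinearEquiv.symm_apply_apply]
  -- naturality of the Hurewicz class under the page push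
  have hpath : loopPath (fun θ => ((bBase g).incl (Ψ (lam ⟨K θ, hKp θ⟩)) : Base g))
      ((continuous_pagePush D bX Ψ hfree hlam).comp (hK.subtype_mk hKp)) =
      (loopPath (fun θ => (⟨K θ, hKp θ⟩ : ↥(page g c))) (hK.subtype_mk hKp)).map F.continuous := by
    ext s; rfl
  have hmap : (singularHomology.map ℤ ℤ F 1).hom (loopClass ℤ ℤ (1 : ℤ)
      (loopPath (fun θ => (⟨K θ, hKp θ⟩ : ↥(page g c))) (hK.subtype_mk hKp))) =
      loopClass ℤ ℤ (1 : ℤ) ((loopPath (fun θ => (⟨K θ, hKp θ⟩ : ↥(page g c)))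
        (hK.subtype_mk hKp)).map F.continuous) :=
    map_loopClass ℤ ℤ (1 : ℤ) _ F
  show shadowMap g (loopClass ℤ ℤ (1 : ℤ) (loopPath _ _)) =
    shadowMap g ((singularHomology.map ℤ ℤ F 1).hom (e.symm (shadow g K hK)))
  rw [hx', hmap, hpath]

/-- **ST3a — the shadow of the seam push of page knots off the cores, at a non-critical direction,
is a `ℤ`-linear function of their shadow.**  For a unit `c` whose page misses the cores there is a
`ℤ`-linear `A : ℤ^{2g} → ℤ^{2g}` such that for every page loop `K ⊂ page g c` with lifts `z` of its
points through `bX.incl` (`bX.incl (z θ) = D.jA (K θ)`), the pushed loop `θ ↦ (bBase g).incl (Ψ (z θ))`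
has `shadow = A (shadow K)` (the lifts are forced to be `λ ∘ K` for any page lift `λ`).
[cite: HatcherAT2002, Thm. 2A.1] -/
theorem seam_shadowLinear [IsManifold (𝓡∂ 4) ∞ X] (hc : ‖c‖ = 1) (hfree : ∀ a ∈ page g c, a ∈ coresComplement h) :
    ∃ A : (Fin g ⊕ Fin g → ℤ) →ₗ[ℤ] (Fin g ⊕ Fin g → ℤ),
      ∀ (K : sphere (0 : EuclideanSpace ℝ (Fin 2)) 1 → Base g) (hKc : Continuous K)
        (hK : ∀ θ, K θ ∈ coresComplement h) (_ : ∀ θ, K θ ∈ page g c)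
        (z : sphere (0 : EuclideanSpace ℝ (Fin 2)) 1 → bX.carrier)
        (_ : ∀ θ, bX.incl (z θ) = D.jA ⟨K θ, hK θ⟩)
        (hGz : Continuous fun θ => ((bBase g).incl (Ψ (z θ)) : Base g)),
        shadow g (fun θ => ((bBase g).incl (Ψ (z θ)) : Base g)) hGz = A (shadow g K hKc) := by
  obtain ⟨lam, hlam⟩ := exists_pageLift D bX hc hfree
  obtain ⟨A, hA⟩ := exists_shadowLinear D bX Ψ hc hfree hlam
  refine ⟨A, fun K hKc hK hKp z hz hGz => ?_⟩
  have hzl : z = fun θ => lam ⟨K θ, hKp θ⟩ := funext fun θ =>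
    bX.injective_incl (by rw [hz, hlam])
  subst hzl
  exact hA K hKc hKp

/-- **Sub-goal `helper_seam_shadowLinear` of stub `stub_steinRealisation`** (NF6 ▸ T3 ▸ T3c-2 ▸ ST3
`node_ST3_shadowTransport`, brick ST3a; wave 4, lead c5): for the data `(D, bX, Ψ)` of a model
(`X = Base g ∪ handles`, seam `Ψ : bX.carrier ≅ ∂ Base g`) and a unit direction `c` whose page misses
the cores, there is a `ℤ`-linear `A : ℤ^{2g} → ℤ^{2g}` such that every page loop `K ⊂ page g c` with
lifts `z` of its points through `bX.incl` is pushed by `(bBase g).incl ∘ Ψ` to a loop of shadow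
`A (shadow K)`. [cite: HatcherAT2002, Thm. 2A.1] -/
theorem helper_seam_shadowLinear : ∀ (g : ℕ) (ι : Type) [Finite ι] (h : ι → Literature.Topology.FourManifolds.HandleAttachingMap 3 2 (Literature.Topology.FourManifolds.LefschetzBase.Base g)) (X : Type) [TopologicalSpace X] [T2Space X] [ChartedSpace (EuclideanHalfSpace 4) X] [IsManifold (𝓡∂ 4) ∞ X] (D : Literature.Topology.FourManifolds.HandleAttachingMap.MultiAttachmentData h (𝓡∂ 4) X) (bX : Literature.Topology.FourManifolds.BoundaryData (𝓡∂ 4) X (𝓡 3)) (Ψ : bX.carrier ≃ₘ⟮𝓡 3, 𝓡 3⟯ (Literature.Topology.FourManifolds.LefschetzBase.bBase g).carrier) (c : ℂ), ‖c‖ = 1 → (∀ a ∈ Literature.Topology.FourManifolds.LefschetzBase.page g c, a ∈ Literature.Topology.FourManifolds.HandleAttachingMap.coresComplement h) → ∃ A : (Fin g ⊕ Fin g → ℤ) →ₗ[ℤ] (Fin g ⊕ Fin g → ℤ), ∀ (K : Metric.sphere (0 : EuclideanSpace ℝ (Fin 2)) 1 → Literature.Topology.FourManifolds.LefschetzBase.Base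 g) (hKc : Continuous K) (hK : ∀ θ, K θ ∈ Literature.Topology.FourManifolds.HandleAttachingMap.coresComplement h), (∀ θ, K θ ∈ Literature.Topology.FourManifolds.LefschetzBase.page g c) → ∀ (z : Metric.sphere (0 : EuclideanSpace ℝ (Fin 2)) 1 → bX.carrier), (∀ θ, bX.incl (z θ) = D.jA ⟨K θ, hK θ⟩) → ∀ (hGz : Continuous fun θ => ((Literature.Topology.FourManifolds.LefschetzBase.bBase g).incl (Ψ (z θ)) : Literature.Topology.FourManifolds.LefschetzBase.Base g)), Literature.Topology.FourManifolds.LefschetzBase.shadow g (fun θ => ((Literature.Topology.FourManifolds.LefschetzBase.bBase g).incl (Ψ (z θ)) : Literature.Topology.FourManifolds.LefschetzBase.Base g)) hGz = A (Literature.Topology.FourManifolds.LefschetzBase.shadow g K hKc) :=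
  fun _ _ _ _ _ _ _ _ _ D bX Ψ _ hc hfree => seam_shadowLinear D bX Ψ hc hfree

end ShadowLinear

end Summit.SmoothPoincare4.SmoothPoincare4.Theorems.AcyclicBisectionExists.ModpBraidOrbits

end
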